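import Summits.HubbardSuperconductivity.HubbardSuperconductivity.Theorems.ThermalWedgeTwTipContinuationEdgeOrderChord
import Summits.HubbardSuperconductivity.HubbardSuperconductivity.Theorems.ThermalWedgeTwTipContinuationEdgeOrderFreeBound
import Summits.HubbardSuperconductivity.HubbardSuperconductivity.Theorems.ThermalWedgeTwTipContinuationEdgeOrderSectors
import Summits.HubbardSuperconductivity.HubbardSuperconductivity.Theorems.ThermalWedgeTwTipContinuationEdgeOrderPairAddition
import Summits.HubbardSuperconductivity.HubbardSuperconductivity.Theorems.ThermalWedgeTwTipContinuationEdgeOrderBCSTrial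
import Summits.HubbardSuperconductivity.HubbardSuperconductivity.Theorems.ThermalWedgeTwTipContinuationEdgeOrderTuning
import Summits.HubbardSuperconductivity.HubbardSuperconductivity.Theorems.ThermalWedgeTwTipContinuationEdgeOrderTransfer
import Summits.HubbardSuperconductivity.HubbardSuperconductivity.Theorems.ThermalWedgeTwTipContinuationEdgeOrderCooperLog

/-!
# `TwTipContinuation` (stmt-HubbardSuperconductivity-1700), line `isogap-submodular-transport`:
# the stub `stub_edgeOrder` — every ground state of the `U = 0` reduced d-wave BCS torus is ordered

Assembly of the pieces: for `δ ∈ [1/10, 2/5]` and `c > 0`,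
1. (Cooper) fix `s = 3/10` and a gap parameter `D = D(c) ∈ (0, 1/100]` with
   `L⁻² Σ_k ĝ_d²/(2r_k) ≥ max(2, 1/(4c))` for all `|μ| ≤ 3.82`, eventually in even `L`
   (`exists_gap_cooperLog`);
2. (tuning) at each large `L` choose `μ_L`, `|μ_L| ≤ 19/5`, with mean number
   `N̄ = 2n_L − 2KL`, `n_L = ⌊(1−δ)L²/2⌋`, `K = (16 + cC_d)/D² + 1` (`exists_mu_of_target`);
3. (BCS) the regularised trial state has `re⟨Ψ,H_cΨ⟩ ≤ Σ_k 2min(ξ_k,0) + μN̄ − D²L²`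
   (`trial_energy_le`), unit norm, spin balance, number variance `≤ L²`;
4. (sectors + transfer) its sector weights turn this into
   `E_L(0,c) ≤ Σ_k 2min(ξ_k,0) + μN̄ − D²L² + C₀(3/4 + K²)L + (16 + cC_d)L²/(4K²)`
   (`sum_weight_mul_le_expect`, `pairAddition_cost`, `sector_transfer`);
5. (free side) `E_L(0,0) ≥ Σ_k 2min(ξ_k,0) + 2μ n_L` (`freeSectorEnergy_ge`);
so `E_L(0,0) − E_L(0,c) ≥ D²L²/2` eventually (`extensiveGap`), and the chord reduction
`edgeOrder_of_extensiveGap` gives the stub with `μ = D²/(2c)`.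
-/

noncomputable section

namespace Summit.HubbardSuperconductivity.TwTipContinuation.IsogapTransport

open Matrix Filter Finset
open Literature.MathematicalPhysics.QuantumLattice Literature.Probability.LatticeModels
open Summit.HubbardSuperconductivity.TwTipContinuation.Negative
open scoped ComplexOrder

/-- `Σ_k 2 min(ε_L(k) − 0, 0) ≥ −8L²`. [folklore] -/
theorem sum_two_min_ge (L : ℕ) [NeZero L] : -8 * (L : ℝ) ^ 2 ≤ ∑ k : TorusSite 2 L, 2 * min (torusBand L k - 0) 0 := by
  calc -8 * (L : ℝ) ^ 2 = ∑ _k : TorusSite 2 L, (-8 : ℝ) := by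
        rw [Finset.sum_const, Finset.card_univ, card_torusSite_two, nsmul_eq_mul]; push_cast; ring
    _ ≤ _ := Finset.sum_le_sum fun k _ => by
        have := neg_four_le_torusBand L k
        rw [sub_zero]
        have : -4 ≤ min (torusBand L k) 0 := le_min this (by norm_num)
        linarith

/-- **A priori spread of the seeded sector energies**: `E(2n) ≤ E(2m) + (16 + cC_d)L²` for all
`n, m ≤ L²` (`L ≥ 3`, `c ≥ 0`). [folklore] -/
theorem seededSectorEnergy_spread {L : ℕ} [NeZero L] (hL : 3 ≤ L) {c : ℝ} (hc : 0 ≤ c) {n m : ℕ}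
    (hn : n ≤ Fintype.card (FermionTorus 2 L)) (hm : m ≤ Fintype.card (FermionTorus 2 L)) :
    Matrix.minEnergyOn (hubbardTorus 2 L 1 0 - ((c / (L : ℝ) ^ 2 : ℝ) : ℂ) • ((pairField dWaveFormFactor L)ᴴ * pairField dWaveFormFactor L)) (szSector (2 * n) 0) ≤
      Matrix.minEnergyOn (hubbardTorus 2 L 1 0 - ((c / (L : ℝ) ^ 2 : ℝ) : ℂ) • ((pairField dWaveFormFactor L)ᴴ * pairField dWaveFormFactor L)) (szSector (2 * m) 0) +
        (16 + c * (∑ e ∈ insert 0 unitSteps, ‖((dWaveFormFactor e / Real.sqrt 2 : ℝ) : ℂ)‖ * 2) ^ 2) * (L : ℝ) ^ 2 := by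
  have h1 := seededSectorEnergy_le hL hc hn
  have h2 := seededSectorEnergy_ge hL 0 hc hm
  have h3 := sum_two_min_ge L
  rw [zero_mul, add_zero] at h2
  nlinarith

/-- **One large even side.** The quantitative core of the stub: given the Cooper bound at the
tuned chemical potential, the trial state, its sector decomposition and the pair-addition cost give
`E_L(0,0) − E_L(0,c) ≥ μ(2n − N̄) + D²L² − C₀(L/2 + (L² + (2n−N̄)²)/(4L)) − (16 + cC_d)L² · L²/(2n−N̄)²`.
[folklore] -/
theorem gap_at_side {L : ℕ} [NeZero L] (hL : 3 ≤ L) {c D μ : ℝ} (hc : 0 < c) (hD : 0 < D) {n : ℕ}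
    (hn2 : 2 * (n : ℝ) ≤ (L : ℝ) ^ 2)
    (hS1 : 2 * (L : ℝ) ^ 2 ≤ ∑ k : TorusSite 2 L, dWaveGap k ^ 2 /
      (2 * Real.sqrt ((torusBand L k - μ) ^ 2 + D ^ 2 * dWaveGap k ^ 2 + D ^ 4)))
    (hS2 : (L : ℝ) ^ 2 ≤ 4 * c * ∑ k : TorusSite 2 L, dWaveGap k ^ 2 /
      (2 * Real.sqrt ((torusBand L k - μ) ^ 2 + D ^ 2 * dWaveGap k ^ 2 + D ^ 4)))
    (hgt : ∑ k : TorusSite 2 L, (1 - (torusBand L k - μ) / Real.sqrt ((torusBand L k - μ) ^ 2 + D ^ 2 * dWaveGap k ^ 2 + D ^ 4)) <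
      2 * n) :
    μ * (2 * n - ∑ k : TorusSite 2 L, (1 - (torusBand L k - μ) / Real.sqrt ((torusBand L k - μ) ^ 2 + D ^ 2 * dWaveGap k ^ 2 + D ^ 4))) +
        D ^ 2 * (L : ℝ) ^ 2 -
        (8 + c * ((∑ e ∈ insert 0 unitSteps, ‖((dWaveFormFactor e / Real.sqrt 2 : ℝ) : ℂ)‖ * 2) ^ 2 / 2 + 256)) *
          ((L : ℝ) / 2 + ((L : ℝ) ^ 2 + (2 * n - ∑ k : TorusSite 2 L, (1 - (torusBand L k - μ) /
            Real.sqrt ((torusBand L k - μ) ^ 2 + D ^ 2 * dWaveGap k ^ 2 + D ^ 4))) ^ 2) / (4 * L)) -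
        (16 + c * (∑ e ∈ insert 0 unitSteps, ‖((dWaveFormFactor e / Real.sqrt 2 : ℝ) : ℂ)‖ * 2) ^ 2) * (L : ℝ) ^ 2 *
          ((L : ℝ) ^ 2 / (2 * n - ∑ k : TorusSite 2 L, (1 - (torusBand L k - μ) /
            Real.sqrt ((torusBand L k - μ) ^ 2 + D ^ 2 * dWaveGap k ^ 2 + D ^ 4))) ^ 2) ≤
      Matrix.minEnergyOn (hubbardTorus 2 L 1 0) (szSector (2 * n) 0) -
        Matrix.minEnergyOn (hubbardTorus 2 L 1 0 - ((c / (L : ℝ) ^ 2 : ℝ) : ℂ) • ((pairField dWaveFormFactor L)ᴴ * pairField dWaveFormFactor L)) (szSector (2 * n) 0) := by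
  have hcard : Fintype.card (FermionTorus 2 L) = L ^ 2 := Summit.HubbardSuperconductivity.NoGo.card_fermionTorus_two L
  have hLr : (0 : ℝ) < L := by exact_mod_cast (show 0 < L by omega)
  have hnL : n ≤ Fintype.card (FermionTorus 2 L) := by
    rw [hcard]
    have : (n : ℝ) ≤ (L : ℝ) ^ 2 := by nlinarith
    exact_mod_cast this
  -- the trial state: energy, norm, spin balance, mean number, variance
  have henergy := trial_energy_le (L := L) μ hD hL hc.le hS1 hS2
  have hnorm := trial_norm (L := L) μ hD
  have hbal := trial_mem_spinBalanced (L := L) (D := D) μ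
  have hvar := trial_variance_le (L := L) μ hD
  have hpres := preservesSectors_seededH 0 c L
  have hfree := freeSectorEnergy_ge L hL μ n hnL
  -- abbreviations
  set Cd := (∑ e ∈ insert 0 unitSteps, ‖((dWaveFormFactor e / Real.sqrt 2 : ℝ) : ℂ)‖ * 2) ^ 2 with hCd
  set H := hubbardTorus 2 L 1 0 - ((c / (L : ℝ) ^ 2 : ℝ) : ℂ) • ((pairField dWaveFormFactor L)ᴴ * pairField dWaveFormFactor L) with hH
  set t : ℝ := ∑ k : TorusSite 2 L, (1 - (torusBand L k - μ) / Real.sqrt ((torusBand L k - μ) ^ 2 + D ^ 2 * dWaveGap k ^ 2 + D ^ 4)) with ht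
  set Ψ := (List.prod (List.map (fun k => (((fun k : TorusSite 2 L => Real.sqrt ((1 + (torusBand L k - μ) /
      Real.sqrt ((torusBand L k - μ) ^ 2 + D ^ 2 * dWaveGap k ^ 2 + D ^ 4)) / 2)) k : ℝ) : ℂ) •
        (1 : Matrix (Finset (Orb (FermionTorus 2 L))) (Finset (Orb (FermionTorus 2 L))) ℂ) +
      (((fun k : TorusSite 2 L => (if 0 ≤ dWaveGap k then 1 else -1) * Real.sqrt ((1 - (torusBand L k - μ) /
        Real.sqrt ((torusBand L k - μ) ^ 2 + D ^ 2 * dWaveGap k ^ 2 + D ^ 4)) / 2)) k : ℝ) : ℂ) • (pairMode k)ᴴ)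
    (Finset.univ : Finset (TorusSite 2 L)).toList) *ᵥ (vacuum : Fock (Orb (FermionTorus 2 L)))) with hΨ
  set F : ℕ → ℝ := fun m => Matrix.minEnergyOn H (szSector (2 * m) 0) with hF
  set w : ℕ → ℝ := fun m => (star (sectorProj m m Ψ) ⬝ᵥ sectorProj m m Ψ).re with hw
  clear_value Ψ
  -- the sector weights
  have hw0 : ∀ m ∈ Finset.range (Fintype.card (FermionTorus 2 L) + 1), 0 ≤ w m := fun m _ => weight_nonneg m Ψ
  have hw1 : ∑ m ∈ Finset.range (Fintype.card (FermionTorus 2 L) + 1), w m = 1 := by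
    simp only [hw]
    rw [sum_weights_eq hbal, hnorm, Complex.one_re]
  have hFvar : ∀ m ∈ Finset.range (Fintype.card (FermionTorus 2 L) + 1), ∀ φ ∈ szSector (Λ := FermionTorus 2 L) (2 * m) (0 : ℝ),
      star φ ⬝ᵥ φ = 1 → F m ≤ (star φ ⬝ᵥ (H *ᵥ φ)).re := by
    intro m hm φ hφ h1
    have hm' : m ≤ Fintype.card (FermionTorus 2 L) := Nat.lt_succ_iff.1 (Finset.mem_range.1 hm)
    exact (seeded_sector_groundState 0 c L hm').2 φ hφ h1
  have hAvg : ∑ m ∈ Finset.range (Fintype.card (FermionTorus 2 L) + 1), w m * F m ≤ (star Ψ ⬝ᵥ (H *ᵥ Ψ)).re := by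
    have h := sum_weight_mul_le_expect hpres hbal F hFvar
    simp only [hw]
    calc ∑ m ∈ Finset.range (Fintype.card (FermionTorus 2 L) + 1), (star (sectorProj m m Ψ) ⬝ᵥ sectorProj m m Ψ).re * F m
        = ∑ m ∈ Finset.range (Fintype.card (FermionTorus 2 L) + 1), F m * (star (sectorProj m m Ψ) ⬝ᵥ sectorProj m m Ψ).re :=
          Finset.sum_congr rfl fun m _ => mul_comm _ _
      _ ≤ _ := h
  have hV : ∑ m ∈ Finset.range (Fintype.card (FermionTorus 2 L) + 1), w m * (2 * m - t) ^ 2 ≤ (L : ℝ) ^ 2 := by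
    have h := variance_totalNumber_eq_sum_sectors hbal t
    simp only [hw]
    calc ∑ m ∈ Finset.range (Fintype.card (FermionTorus 2 L) + 1), (star (sectorProj m m Ψ) ⬝ᵥ sectorProj m m Ψ).re * (2 * m - t) ^ 2
        = ∑ m ∈ Finset.range (Fintype.card (FermionTorus 2 L) + 1), (2 * m - t) ^ 2 * (star (sectorProj m m Ψ) ⬝ᵥ sectorProj m m Ψ).re :=
          Finset.sum_congr rfl fun m _ => mul_comm _ _
      _ = _ := h.symm
      _ ≤ (L : ℝ) ^ 2 := hvar
  -- the pair-addition cost and the a priori spread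
  have hadd : ∀ m, m < n → F (m + 1) ≤ F m + (8 + c * (Cd / 2 + 256)) := by
    intro m hm
    have h2m : 2 * m ≤ L ^ 2 := by
      have : 2 * (m : ℝ) ≤ (L : ℝ) ^ 2 := by
        have : (m : ℝ) < n := by exact_mod_cast hm
        linarith
      exact_mod_cast this
    exact pairAddition_cost hL hc.le h2m
  have hbig : ∀ m ∈ Finset.range (Fintype.card (FermionTorus 2 L) + 1), n < m → F n ≤ F m + (16 + c * Cd) * (L : ℝ) ^ 2 := by
    intro m hm _
    have hm' : m ≤ Fintype.card (FermionTorus 2 L) := Nat.lt_succ_iff.1 (Finset.mem_range.1 hm)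
    exact seededSectorEnergy_spread hL hc.le hnL hm'
  -- transfer to the sector `n`
  have hC₀ : 0 ≤ 8 + c * (Cd / 2 + 256) := by positivity
  have hB : 0 ≤ (16 + c * Cd) * (L : ℝ) ^ 2 := by positivity
  have hg : 0 < 2 * (n : ℝ) - t := by linarith
  have htrans := sector_transfer (M := Fintype.card (FermionTorus 2 L)) hC₀ hB hLr hw0 hw1 hAvg hV hg hadd hbig
  -- the free side and the conclusion
  have hFn : F n = Matrix.minEnergyOn H (szSector (2 * n) 0) := rfl
  rw [hFn] at htrans
  nlinarith [htrans, henergy, hfree]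

/-- Pure arithmetic of the final budget: with `2n − t = 2KL`, `K ≥ 1`, `K ≥ B₂/D² `, `|μ| ≤ 19/5` and
`L ≥ 4Λ₁/D²`, `Λ₁ = (38/5)K + C₀(3/4 + K²)`, the lower bound of `gap_at_side` is at least `D²L²/2`.
[folklore] -/
theorem budget_arith {μ D K C₀ B₂ L g : ℝ} (hD : 0 < D) (hL : 0 < L) (hK1 : 1 ≤ K) (hKB : B₂ / D ^ 2 ≤ K)
    (hμ : |μ| ≤ 19 / 5) (hg : g = 2 * K * L)
    (hbig : 4 * ((38 / 5) * K + C₀ * (3 / 4 + K ^ 2)) / D ^ 2 ≤ L) :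
    D ^ 2 / 2 * L ^ 2 ≤ μ * g + D ^ 2 * L ^ 2 - C₀ * (L / 2 + (L ^ 2 + g ^ 2) / (4 * L)) - B₂ * L ^ 2 * (L ^ 2 / g ^ 2) := by
  have hK0 : 0 < K := by linarith
  rw [abs_le] at hμ
  -- term by term
  have h1 : -(38 / 5) * K * L ≤ μ * g := by rw [hg]; nlinarith [mul_pos hK0 hL]
  have h3 : C₀ * (L / 2 + (L ^ 2 + g ^ 2) / (4 * L)) = C₀ * (3 / 4 + K ^ 2) * L := by
    rw [hg]; field_simp; ring
  have h4 : B₂ * L ^ 2 * (L ^ 2 / g ^ 2) ≤ D ^ 2 / 4 * L ^ 2 := by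
    rw [hg]
    have hK2 : B₂ / D ^ 2 ≤ K ^ 2 := hKB.trans (by nlinarith)
    rw [div_le_iff₀ (by positivity)] at hK2
    have e : B₂ * L ^ 2 * (L ^ 2 / (2 * K * L) ^ 2) = B₂ / (4 * K ^ 2) * L ^ 2 := by field_simp; ring
    rw [e]
    refine mul_le_mul_of_nonneg_right ?_ (by positivity)
    rw [div_le_iff₀ (by positivity)]
    nlinarith
  have h5 : ((38 / 5) * K + C₀ * (3 / 4 + K ^ 2)) * L ≤ D ^ 2 / 4 * L ^ 2 := by
    rw [div_le_iff₀ (by positivity)] at hbig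
    nlinarith
  rw [h3]
  nlinarith

/-- **The extensive gap at the `U = 0` edge.** For `δ ∈ [1/10, 2/5]` and `c > 0` there is `κ > 0`
such that, eventually in even `L`, `κ L² ≤ E_L(0,0) − E_L(0,c)` in the canonical sector
`(2⌊(1−δ)L²/2⌋, S^z = 0)`. [folklore] -/
theorem extensiveGap (δ : ℝ) (hδ : δ ∈ Set.Icc (1 / 10 : ℝ) (2 / 5)) (c : ℝ) (hc : 0 < c) :
    ∃ κ : ℝ, 0 < κ ∧ ∃ L₀ : ℕ, ∀ (L : ℕ) [NeZero L], L₀ ≤ L → Even L →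
      κ * (L : ℝ) ^ 2 ≤
        (Matrix.minEnergyOn (hubbardTorus 2 L 1 0) (szSector (2 * ⌊(1 - δ) * (L : ℝ) ^ 2 / 2⌋₊) 0))
          - (Matrix.minEnergyOn (hubbardTorus 2 L 1 0 - ((c / (L : ℝ) ^ 2 : ℝ) : ℂ) • ((pairField dWaveFormFactor L)ᴴ * pairField dWaveFormFactor L)) (szSector (2 * ⌊(1 - δ) * (L : ℝ) ^ 2 / 2⌋₊) 0)) := by
  obtain ⟨hδ1, hδ2⟩ := hδ
  -- the gap parameter from the Cooper logarithm (`s = 3/10`, target `max 2 (1/(4c))`)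
  obtain ⟨D, hD, hD100, L₁, hcoop⟩ := exists_gap_cooperLog (s := 3 / 10) (by norm_num) (by norm_num) (max 2 (1 / (4 * c)))
  set Cd := (∑ e ∈ insert 0 unitSteps, ‖((dWaveFormFactor e / Real.sqrt 2 : ℝ) : ℂ)‖ * 2) ^ 2 with hCd
  have hCd0 : 0 ≤ Cd := by positivity
  set C₀ : ℝ := 8 + c * (Cd / 2 + 256) with hC₀
  set B₂ : ℝ := 16 + c * Cd with hB₂
  set K : ℝ := B₂ / D ^ 2 + 1 with hK
  have hK1 : 1 ≤ K := by rw [hK]; exact le_add_of_nonneg_left (by positivity)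
  have hK0 : 0 ≤ K := by linarith
  have hKB : B₂ / D ^ 2 ≤ K := by rw [hK]; linarith
  obtain ⟨L₂, htune⟩ := exists_mu_of_target hD hD100 (K := K) hK0
  set Λ₁ : ℝ := (38 / 5) * K + C₀ * (3 / 4 + K ^ 2) with hΛ₁
  refine ⟨D ^ 2 / 2, by positivity, max L₁ (max L₂ (max 3 ⌈4 * Λ₁ / D ^ 2⌉₊)), fun L _ hL hE => ?_⟩
  have hL₁ : L₁ ≤ L := (le_max_left _ _).trans hL
  have hL₂ : L₂ ≤ L := ((le_max_left _ _).trans (le_max_right _ _)).trans hL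
  have hL3 : 3 ≤ L := (((le_max_left _ _).trans (le_max_right _ _)).trans (le_max_right _ _)).trans hL
  have hLbig : 4 * Λ₁ / D ^ 2 ≤ (L : ℝ) :=
    (Nat.ceil_le.1 ((((le_max_right _ _).trans (le_max_right _ _)).trans (le_max_right _ _)).trans hL))
  have hLr : (0 : ℝ) < L := by exact_mod_cast (show 0 < L by omega)
  -- the sector and the target mean number
  set n : ℕ := ⌊(1 - δ) * (L : ℝ) ^ 2 / 2⌋₊ with hn
  have hx0 : 0 ≤ (1 - δ) * (L : ℝ) ^ 2 / 2 := by
    have : 0 ≤ 1 - δ := by linarith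
    positivity
  have hnle : (n : ℝ) ≤ (1 - δ) * (L : ℝ) ^ 2 / 2 := Nat.floor_le hx0
  have hnge : (1 - δ) * (L : ℝ) ^ 2 / 2 < n + 1 := Nat.lt_floor_add_one _
  have hn2 : 2 * (n : ℝ) ≤ (L : ℝ) ^ 2 := by nlinarith
  set t : ℝ := 2 * n - 2 * K * L with ht
  have ht1 : 3 / 5 * (L : ℝ) ^ 2 - 2 * K * L - 2 ≤ t := by rw [ht]; nlinarith
  have ht2 : t ≤ 9 / 10 * (L : ℝ) ^ 2 := by
    rw [ht]
    have : 0 ≤ 2 * K * (L : ℝ) := by positivity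
    nlinarith
  obtain ⟨μ, hμ, hocc⟩ := htune L hL₂ t ht1 ht2
  -- the Cooper bound at the tuned chemical potential
  have hμ' : |μ| ≤ 4 - 2 * (3 / 10 : ℝ) ^ 2 := hμ.trans (by norm_num)
  have hS := hcoop L hL₁ hE μ hμ'
  set S := ∑ k : TorusSite 2 L, dWaveGap k ^ 2 /
    (2 * Real.sqrt ((torusBand L k - μ) ^ 2 + D ^ 2 * dWaveGap k ^ 2 + D ^ 4)) with hSdef
  have hL2pos : (0 : ℝ) < (L : ℝ) ^ 2 := by positivity
  rw [le_inv_mul_iff₀ hL2pos] at hS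
  have hS1 : 2 * (L : ℝ) ^ 2 ≤ S := by nlinarith [le_max_left (2 : ℝ) (1 / (4 * c))]
  have hS2 : (L : ℝ) ^ 2 ≤ 4 * c * S := by
    have h := (mul_le_mul_of_nonneg_left (le_max_right (2 : ℝ) (1 / (4 * c))) hL2pos.le).trans hS
    rw [show (L : ℝ) ^ 2 * (1 / (4 * c)) = (L : ℝ) ^ 2 / (4 * c) by ring, div_le_iff₀ (by positivity)] at h
    linarith
  -- the side estimate
  have hgt : ∑ k : TorusSite 2 L, (1 - (torusBand L k - μ) / Real.sqrt ((torusBand L k - μ) ^ 2 + D ^ 2 * dWaveGap k ^ 2 + D ^ 4)) <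
      2 * n := by
    rw [hocc, ht]
    have : 0 < 2 * K * (L : ℝ) := by positivity
    linarith
  have hside := gap_at_side hL3 hc hD hn2 hS1 hS2 hgt
  rw [hocc] at hside
  have hg : 2 * (n : ℝ) - t = 2 * K * L := by rw [ht]; ring
  have hbud := budget_arith (C₀ := C₀) (B₂ := B₂) hD hLr hK1 hKB hμ hg (by rw [hΛ₁] at hLbig; exact hLbig)
  rw [← hCd, ← hC₀, ← hB₂] at hside
  linarith

/-- STUB `stub_edgeOrder` of the line `isogap-submodular-transport` (crux `TwTipContinuation`):
**every ground state of the `U = 0` reduced d-wave BCS torus is d-wave ordered.** For every doping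
`δ ∈ [1/10, 2/5]` and seed `c > 0` there is `μ > 0` such that, eventually in even `L`, every
normalised ground state of `hubbardTorus 2 L 1 0 − (c/L²)(pairField d L)ᴴ(pairField d L)` in the
sector `(2⌊(1−δ)L²/2⌋, S^z = 0)` has `μ L⁴ ≤ re⟨ψ, (pairField d L)ᴴ(pairField d L) ψ⟩`: extensive
gap at the free edge (`extensiveGap`: BCS trial state + Cooper logarithm + sector transfer) and the
left chord (`edgeOrder_of_extensiveGap`). Bardeen–Cooper–Schrieffer 1957; Bogoliubov 1958;
Leggett, *Quantum Liquids* (2006) §5.4. [folklore] -/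
theorem stub_edgeOrder :
    ∀ δ ∈ Set.Icc (1 / 10 : ℝ) (2 / 5), ∀ c : ℝ, 0 < c → ∃ μ : ℝ, 0 < μ ∧ ∃ L₀ : ℕ, ∀ (L : ℕ) [NeZero L], L₀ ≤ L → Even L →
      ∀ ψ : Fock (Orb (FermionTorus 2 L)), star ψ ⬝ᵥ ψ = 1 →
        IsGroundStateInSector (hubbardTorus 2 L 1 0 - ((c / (L : ℝ) ^ 2 : ℝ) : ℂ) • ((pairField dWaveFormFactor L)ᴴ * pairField dWaveFormFactor L)) (2 * ⌊(1 - δ) * (L : ℝ) ^ 2 / 2⌋₊) 0 ψ →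
          μ * (L : ℝ) ^ 4 ≤ (expect ((pairField dWaveFormFactor L)ᴴ * pairField dWaveFormFactor L) ψ).re :=
  fun δ hδ c hc => edgeOrder_of_extensiveGap δ c hc (extensiveGap δ hδ c hc)

end Summit.HubbardSuperconductivity.TwTipContinuation.IsogapTransport
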